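import Literature.NumberTheory.Automorphic.WhittakerMultiplicityOneReduction
import HarnessLib

/-!
# Parabolically induced representations of `GL_n(F)` have at most one Whittaker functional

Topic `NumberTheory/Automorphic`. The multiplicity-free half of Rodier's heredity theorem in its
usual working form (Rodier 1973; Bernstein–Zelevinsky 1977, Cor. 4.6 in top degree and §4.7;
Shahidi, Casselman–Shalika use it in this form): for an irreducible *admissible* representation `σ`
of the standard Levi `M = Π_a GL(B_a, F)` of `GL_n(F)` (`c : Fin n → Fin r` monotone),

  `dim Hom_{U_n}(i_c σ, ψ_U) ≤ 1`,

granted local multiplicity one for the irreducible smooth representations of the `GL_{n_a}(F)`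
(`rank_whittakerFunctionals_parabolicIndGL_le_one`; the hypothesis is the named fact
`rank_whittakerFunctionals_le_one` for the blocks, in the form
`rank_whittakerFunctionals_parabolicIndGL_le_one_of_fact`). No supercuspidality is assumed: the
tensor factors of `σ` (Flath, `FiniteTensorDecomposition`) are irreducible admissible, the Levi
relation block by block (`LeviWhittakerLower`) and the slot-by-slot bound
(`RestrictedTensorCoinvariantBound`) give `rank (W / M_θ) ≤ 1`, and heredity
(`exists_injective_whittakerFunctionals_smoothIndRep`) embeds the Whittaker functionals of `i_c σ`
into the dual of `W / M_θ`. Theorems only; no named fact.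

## References

* F. Rodier, *Whittaker models for admissible representations of reductive `p`-adic split
  groups*, Proc. Sympos. Pure Math. 26 (1973), 425–430.
* I. N. Bernstein, A. V. Zelevinsky, *Induced representations of reductive `p`-adic groups I*,
  Ann. Sci. ÉNS 10 (1977), Cor. 4.6, §4.7. [BernsteinZelevinskyASENS1977]
-/

noncomputable section

namespace Literature.NumberTheory.Automorphic

universe u

section Admissible

variable {F : Type u} [Field F] [ValuativeRel F] [TopologicalSpace F] [IsNonarchimedeanLocalField F]
  {n r : ℕ} (c : Fin n → Fin r) (ψ : AddChar F Circle)
  {W : Type u} [AddCommGroup W] [Module ℂ W] (σ : Representation ℂ (Π a, GL {i // c i = a} F) W)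

/-- **`rank (W / M_θ) ≤ 1` for an irreducible admissible `σ`**, granted multiplicity one for the
irreducible smooth representations of the `GL_{n_a}(F)`: `σ ≅ ⊗ ρ_a` (Flath) with `ρ_a`
irreducible admissible, and `(⊗ ρ_a)_{U_M,θ}` is spanned by the image of `⊗ e_a` when each
`(ρ_a)_{U_a,θ_a}` is spanned by `ē_a`. (Bernstein–Zelevinsky 1977, Cor. 4.6, §4.7.)
[cite: BernsteinZelevinskyASENS1977, §4.7] -/
theorem rank_quotient_leviWhittakerKer_le_one_of_isAdmissible [σ.IsIrreducible] (hadm : σ.IsAdmissible)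
    (hGL : ∀ (a : Fin r) (V : Type u) [AddCommGroup V] [Module ℂ V]
      (ρ : Representation ℂ (GL (Fin (Fintype.card {i // c i = a})) F) V),
      ρ.IsIrreducible → ρ.IsSmooth → Module.rank ℂ ↥(whittakerFunctionals ρ ψ) ≤ 1) :
    Module.rank ℂ (W ⧸ leviWhittakerKer c ψ σ) ≤ 1 := by
  classical
  haveI : ∀ a, NonarchimedeanGroup (GL {i // c i = a} F) := fun a => nonarchimedeanGroup_block F c a
  haveI : ∀ a, LocallyCompactSpace (GL {i // c i = a} F) := fun a => locallyCompactSpace_gl' F _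
  choose K hKo hKc using fun a => Representation.exists_isOpen_isCompact_subgroup (G := GL {i // c i = a} F)
  obtain ⟨V, _, _, ρ, x₀, j, hj, hspan, hequiv, hρ⟩ := exists_tensorDecomposition (K := K) hKo hKc σ hadm
  have hfac : ∀ a, ∃ e : V a, ∀ v : V a, ∃ t : ℂ,
      v - t • e ∈ Representation.Coinvariants.ker
        (whittakerTwist ((ρ a).comp (reindexGL (k := F) (blockEnumRev c a)).toMonoidHom) ψ) := by
    intro a
    haveI : (ρ a).IsIrreducible := (hρ a).1
    set ρ' : Representation ℂ (GL (Fin (Fintype.card {i // c i = a})) F) (V a) :=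
      (ρ a).comp (reindexGL (k := F) (blockEnumRev c a)).toMonoidHom with hρ'
    haveI : ρ'.IsIrreducible :=
      isIrreducible_comp_of_surjective (ρ a) _ (reindexGL (k := F) (blockEnumRev c a)).surjective
    have h1 : ρ'.IsSmooth := IsSmooth.comp_of_continuous (ρ a) _ (continuous_reindexGL _) (hρ a).2.isSmooth
    have h3 : Module.rank ℂ (twistedJacquet ρ' ψ) ≤ 1 :=
      (rank_whittakerFunctionals_le_one_iff ψ ρ').1 (hGL a (V a) ρ' inferInstance h1)
    rw [rank_le_one_iff] at h3
    obtain ⟨q₀, hq₀⟩ := h3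
    obtain ⟨e, rfl⟩ := Representation.Coinvariants.mk_surjective _ q₀
    refine ⟨e, fun v => ?_⟩
    obtain ⟨t, ht⟩ := hq₀ (Representation.Coinvariants.mk _ v)
    refine ⟨t, (Representation.Coinvariants.mk_eq_iff _).1 ?_⟩
    rw [map_smul]
    exact ht.symm
  choose e he using hfac
  refine rank_quotient_le_one_of_span_range_eq_top hj
    (fun a => Representation.Coinvariants.ker
      (whittakerTwist ((ρ a).comp (reindexGL (k := F) (blockEnumRev c a)).toMonoidHom) ψ))
    (leviWhittakerKer c ψ σ) (fun x a => ?_) e he hspan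
  rw [ker_whittakerTwist_eq_span, Submodule.span_le]
  rintro _ ⟨⟨u, y⟩, rfl⟩
  rw [SetLike.mem_coe, Submodule.mem_comap]
  dsimp only
  rw [map_sub, map_smul, IsRestrictedMultilinear.slot_apply, IsRestrictedMultilinear.slot_apply,
    MonoidHom.comp_apply, MulEquiv.coe_toMonoidHom, ← RestrictedFamily.piSmul_mulSingle_update ρ, hequiv]
  exact sub_smul_mem_leviWhittakerKer c ψ σ a u _

/-- **Parabolically induced representations have at most one Whittaker functional** (Rodier 1973;
Bernstein–Zelevinsky 1977, Cor. 4.6 / §4.7): for `c` monotone, `ψ` non-trivial continuous and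
`σ` an irreducible admissible representation of the Levi `Π_a GL(B_a, F)` (space in the universe of
`F`), `dim Hom_{U_n}(i_c σ, ψ_U) ≤ 1`, granted local multiplicity one for the irreducible smooth
representations of the `GL_{n_a}(F)` on spaces in the universe of `F`.
[cite: BernsteinZelevinskyASENS1977, §4.7] -/
theorem rank_whittakerFunctionals_parabolicIndGL_le_one (hc : Monotone c) (hψ : ψ.IsContinuousNontrivial)
    [σ.IsIrreducible] (hadm : σ.IsAdmissible)
    (hGL : ∀ (a : Fin r) (V : Type u) [AddCommGroup V] [Module ℂ V]
      (ρ : Representation ℂ (GL (Fin (Fintype.card {i // c i = a})) F) V),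
      ρ.IsIrreducible → ρ.IsSmooth → Module.rank ℂ ↥(whittakerFunctionals ρ ψ) ≤ 1) :
    Module.rank ℂ ↥(whittakerFunctionals (Representation.parabolicIndGL F c σ) ψ) ≤ 1 := by
  change Module.rank ℂ ↥(whittakerFunctionals (Representation.smoothIndRep (standardParabolicGL F c)
    (Representation.twist (σ.comp (leviProjection F c)) (rootDeltaChar (standardParabolicGL F c)))) ψ) ≤ 1
  obtain ⟨Λ, hΛ⟩ := exists_injective_whittakerFunctionals_smoothIndRep (F := F) (c := c)
    (σ' := Representation.twist (σ.comp (leviProjection F c)) (rootDeltaChar (standardParabolicGL F c)))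
    ψ hc (hadm.isSmooth.twist_comp_leviProjection F c) (fun p hp => twist_comp_leviProjection_eq_one_of_mem c σ p hp) hψ
  refine (LinearMap.rank_le_of_injective Λ hΛ).trans ?_
  refine (Submodule.rank_mono (leviWhittakerFunctionals_le_dualAnnihilator c ψ σ hc)).trans ?_
  rw [← (leviWhittakerKer c ψ σ).dualQuotEquivDualAnnihilator.rank_eq, rank_dual_le_one_iff]
  exact rank_quotient_leviWhittakerKer_le_one_of_isAdmissible c ψ σ hadm hGL

/-- The same, with the hypothesis phrased through the named fact
`rank_whittakerFunctionals_le_one` for the blocks `GL_m(F)`, `2 ≤ m ≤ n` (blocks of size `≤ 1`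
have multiplicity one outright, `rank_whittakerFunctionals_le_one_of_le_one`); once that fact is
discharged this is the unconditional statement `dim Hom_{U_n}(i_c σ, ψ_U) ≤ 1`.
[cite: BernsteinZelevinskyASENS1977, §4.7] -/
theorem rank_whittakerFunctionals_parabolicIndGL_le_one_of_fact (hc : Monotone c)
    (hψ : ψ.IsContinuousNontrivial) [σ.IsIrreducible] (hadm : σ.IsAdmissible)
    (h : ∀ m : ℕ, 2 ≤ m → m ≤ n → ∀ (V : Type u) [AddCommGroup V] [Module ℂ V]
      (ρ : Representation ℂ (GL (Fin m) F) V), rank_whittakerFunctionals_le_one ρ ψ) :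
    Module.rank ℂ ↥(whittakerFunctionals (Representation.parabolicIndGL F c σ) ψ) ≤ 1 := by
  refine rank_whittakerFunctionals_parabolicIndGL_le_one c ψ σ hc hψ hadm fun a V _ _ ρ h1 h2 => ?_
  haveI := h1
  by_cases hm : Fintype.card {i // c i = a} ≤ 1
  · exact rank_whittakerFunctionals_le_one_of_le_one ρ ψ hm h2 hψ
  · exact h _ (by omega) ((Fintype.card_subtype_le _).trans_eq (Fintype.card_fin n)) V ρ h2 hψ

end Admissible

end Literature.NumberTheory.Automorphic
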